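import Summits.NavierStokesRegularity.FunctionalMining.PalinstrophyLogDoorThreshold
import Summits.NavierStokesRegularity.FunctionalMining.NoGo.PalinstrophyLogKill
import Summits.NavierStokesRegularity.FunctionalMining.NoGo.PalinstrophyLogThresholdWeak
import HarnessLib

/-!
# The K1-Q3 window at the kernel level: `1/40 ≤ C₀(c)` and `{C | (a) holds} = [C₀(c), ∞)` for `0 < c ≤ 1`

Search for candidate a priori estimates; no regularity claim. NS FUNCTIONAL MINING (cell `pub-nsfunc`,
prove seat gen 4). Assembly of three tree results about the typed candidate K1-Q3(a)
`PalinstrophyLogBudget C c` (`d𝒫/dt ≤ C‖ω‖_∞𝒫 log(e + c𝒫/ν²)` along classical NS solutions on `T³`):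
* the dictionary seat's threshold object `logBudgetThreshold c = C₀(c) := inf {C | (a)}`
  (`PalinstrophyLogDoorThreshold.lean`: non-empty by the large-`C` THEOREM
  `palinstrophyLogBudgetLargeC_fin3_holds`, attained, and equal to a closed ray once ONE constant is
  refuted);
* the no-go seat's kernel-checked certificate `not_palinstrophyLogBudget_of_le`
  (`NoGo/PalinstrophyLogKill.lean`: `¬ PalinstrophyLogBudget C c` for `C ≤ 1/40`, `0 ≤ c ≤ 1`, by the
  explicit 12-mode field W12).
Consequences (this file): for `0 < c ≤ 1`, `1/40 ≤ C₀(c)` (`oneFortieth_le_logBudgetThreshold`), the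
valid set is EXACTLY `[C₀(c), ∞)` (`logBudgetValid_eq_Ici_of_le_one`), i.e.
`PalinstrophyLogBudget C c ↔ C₀(c) ≤ C` (`palinstrophyLogBudget_iff_threshold_le`): on this range
K1-Q3(a) is a genuine THRESHOLD LAW with an unconditional two-sided window
`1/40 ≤ C₀(c) ≤ C⋆(c) < ∞`, all kernel-checked. (Paper level, no-go seat, unreviewed: `C₀(c) ≥ 2/π`.)
[ours — internal, unreviewed beyond the kernel]
-/

noncomputable section

namespace Summit.NavierStokesRegularity.FunctionalMining

/-- **`1/40 ≤ C₀(c)` for `0 < c ≤ 1`** (certificate W12 through the threshold socket). [ours] -/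
theorem oneFortieth_le_logBudgetThreshold {c : ℝ} (hc0 : 0 < c) (hc1 : c ≤ 1) :
    (1 : ℝ) / 40 ≤ logBudgetThreshold (d := Fin 3) c :=
  le_logBudgetThreshold_fin3 hc0 (not_palinstrophyLogBudget_of_le le_rfl hc0.le hc1)

/-- **The valid set is the closed ray `[C₀(c), ∞)`** for `0 < c ≤ 1` (unconditionally: the refuted
constant required by `logBudgetValid_eq_Ici_fin3` is supplied by the W12 certificate). [ours] -/
theorem logBudgetValid_eq_Ici_of_le_one {c : ℝ} (hc0 : 0 < c) (hc1 : c ≤ 1) :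
    logBudgetValid (d := Fin 3) c = Set.Ici (logBudgetThreshold (d := Fin 3) c) :=
  logBudgetValid_eq_Ici_fin3 hc0 (not_palinstrophyLogBudget_of_le le_rfl hc0.le hc1)

/-- **K1-Q3(a) is a threshold law on `0 < c ≤ 1`:** `PalinstrophyLogBudget C c ↔ C₀(c) ≤ C`. [ours] -/
theorem palinstrophyLogBudget_iff_threshold_le {C c : ℝ} (hc0 : 0 < c) (hc1 : c ≤ 1) :
    PalinstrophyLogBudget (d := Fin 3) C c ↔ logBudgetThreshold (d := Fin 3) c ≤ C := by
  have h := logBudgetValid_eq_Ici_of_le_one hc0 hc1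
  rw [← mem_logBudgetValid (d := Fin 3), h, Set.mem_Ici]

/-- The threshold is positive on `0 < c ≤ 1` (so `C ≤ 0` never works there). [ours] -/
theorem logBudgetThreshold_pos_of_le_one {c : ℝ} (hc0 : 0 < c) (hc1 : c ≤ 1) :
    0 < logBudgetThreshold (d := Fin 3) c :=
  lt_of_lt_of_le (by norm_num) (oneFortieth_le_logBudgetThreshold hc0 hc1)

/-! ## Appended (prove seat gen 4, after `NoGo/PalinstrophyLogThresholdWeak.lean` p204732): the window for ALL `c > 0`

From `LogDoor.exists_palinstrophyLogBudgetFailsBelow_fin3` (`∃ C₀ > 0, ∀ c > 0, ∀ C < C₀, ¬PLB C c`) and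
`LogDoor.exists_palinstrophyLogBudgetFailsSmallC_fin3`: the threshold is bounded away from zero UNIFORMLY
in `c` (the pointwise positivity of the verdict module `PalinstrophyLogVerdict.lean` decays like `1/log c`; this
does not — and the valid set is the closed ray `[C₀(c), ∞)` for every `c > 0` by that module's
`logBudgetValid_eq_Ici_fin3'`), and grows at least logarithmically as `c → 0`. Constants inexplicit. -/

/-- **`inf_{c>0} C₀(c) > 0`: one positive constant lies below the threshold for every `c > 0`.** [ours] -/
theorem exists_pos_le_logBudgetThreshold :
    ∃ C₁ : ℝ, 0 < C₁ ∧ ∀ c : ℝ, 0 < c → C₁ ≤ logBudgetThreshold (d := Fin 3) c := by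
  obtain ⟨C₀, hC₀, h⟩ := LogDoor.exists_palinstrophyLogBudgetFailsBelow_fin3
  exact ⟨C₀ / 2, by positivity, fun c hc => le_logBudgetThreshold_fin3 hc (h c hc _ (by linarith))⟩

/-- **Small-`c` growth of the threshold:** `∃ κ, c₀ > 0` with `κ log(1/c) ≤ C₀(c)` for all `0 < c < c₀`
(so `C₀(c) → ∞` at least logarithmically as `c → 0`; the dictionary's staged upper shape is affine in
`log(1/c)`). [ours] -/
theorem exists_mul_log_le_logBudgetThreshold :
    ∃ κ c₀ : ℝ, 0 < κ ∧ 0 < c₀ ∧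
      ∀ c : ℝ, 0 < c → c < c₀ → κ * Real.log (1 / c) ≤ logBudgetThreshold (d := Fin 3) c := by
  obtain ⟨κ, hκ, c₀, hc₀, h⟩ := LogDoor.exists_palinstrophyLogBudgetFailsSmallC_fin3
  obtain ⟨C₁, hC₁, hC₁le⟩ := exists_pos_le_logBudgetThreshold
  refine ⟨κ / 2, c₀, by positivity, hc₀, fun c hc hcc => ?_⟩
  rcases le_or_gt (Real.log (1 / c)) 0 with hl | hl
  · have h0 : κ / 2 * Real.log (1 / c) ≤ 0 := mul_nonpos_of_nonneg_of_nonpos (by positivity) hl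
    linarith [hC₁le c hc]
  · exact le_logBudgetThreshold_fin3 hc (h c hc hcc _ (by nlinarith))

end Summit.NavierStokesRegularity.FunctionalMining

end
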